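import Summits.Ventures.PackingBounds.Configurations.IcosahedronLines
import Summits.Ventures.PackingBounds.Configurations.ReflectOrEq

/-!
# Towards the uniqueness of the icosahedron: neighbour sets and the pentagon step

Framing: lottery ticket; floor = certified bounds/negative ranges. Venture `PackingBounds` (cell
`pub-packcert`, seat `pub-packcert-energy`) — Cohn–Kumar Table 1, row `(3, 12)`, uniqueness column.

Input: `C ⊂ S²`, `|C| = 12`, all inner products of distinct points in `{-1} ∪ {t : t² = 1/5}` (the conclusion of
`IcosahedronEnergyRigidity.inner_mem_of_ckPow_energy_eq` for ground states of `(1+t)^k`, `k ≥ 6`). Steps: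
`C` is centrally symmetric (`IcosahedronLines.neg_mem`); for `x ∈ C` the set `N(x)` of points at inner product
`a = 1/√5` has `5` elements; for `y₀ ∈ N(x)` the points of `N(x)` at `±a` from `y₀` number `2 + 2`
(`ReflectOrEq.reflect_or_eq`: at most two unit vectors with prescribed inner products against `x, y₀`); walking
around (`y_{i+1} = 2c(x + y_i) - y_{i-1}`, `c = (√5-1)/4`) exhibits `N(x)` as a pentagon and `C` as the image of a
fixed `12 × 3` coefficient matrix applied to `(x, y₁, y₂)`, whose Gram matrix is therefore the same for every such
`C`; `GramIsometry` then gives the isometry. Main results: `isometric` (any two such configurations are isometric),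
`isometric_icosahedron` (each is an isometric image of `Config.Icosahedron.pts`), and the ground-state form
`isometric_of_ckPow_energy_eq`.

## References
* H. Cohn, A. Kumar, J. Amer. Math. Soc. 20 (2007) 99–148, Table 1. [`CohnKumar2006`]
-/

noncomputable section

namespace Summit.Ventures.PackingBounds.Config.IcosahedronNbr

open Finset Module

/-- `(√5)² = 5`, `2.236 < √5 < 2.2361`. -/
private theorem s5 : Real.sqrt 5 ^ 2 = 5 ∧ (2.236 : ℝ) < Real.sqrt 5 ∧ Real.sqrt 5 < 2.2361 :=
  ⟨Real.sq_sqrt (by norm_num), (Real.lt_sqrt (by norm_num)).mpr (by norm_num),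
    (Real.sqrt_lt' (by norm_num)).mpr (by norm_num)⟩

/-- Unit vectors with inner product `1` are equal. [folklore] -/
private theorem eq_of_inner_eq_one {x y : EuclideanSpace ℝ (Fin 3)} (hx : ‖x‖ = 1) (hy : ‖y‖ = 1)
    (h : inner ℝ x y = 1) : y = x := by
  have h0 : ‖x - y‖ ^ 2 = 0 := by
    rw [← real_inner_self_eq_norm_sq, real_inner_sub_sub_self, real_inner_self_eq_norm_sq,
      real_inner_self_eq_norm_sq, hx, hy, h]; norm_num
  have : x - y = 0 := norm_eq_zero.mp (pow_eq_zero_iff two_ne_zero |>.mp h0)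
  exact (sub_eq_zero.mp this).symm

/-- Unit vectors with inner product `-1` are antipodal. [folklore] -/
private theorem eq_neg_of_inner_eq_neg_one {x y : EuclideanSpace ℝ (Fin 3)} (hx : ‖x‖ = 1) (hy : ‖y‖ = 1)
    (h : inner ℝ x y = -1) : y = -x := by
  have h0 : ‖x + y‖ ^ 2 = 0 := by
    rw [← real_inner_self_eq_norm_sq, real_inner_add_add_self, real_inner_self_eq_norm_sq,
      real_inner_self_eq_norm_sq, hx, hy, h]; norm_num
  have : x + y = 0 := norm_eq_zero.mp (pow_eq_zero_iff two_ne_zero |>.mp h0)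
  exact (neg_eq_of_add_eq_zero_right this).symm

section config

variable {C : Finset (EuclideanSpace ℝ (Fin 3))} (h1 : ∀ x ∈ C, ‖x‖ = 1) (hN : C.card = 12)
  (hv : ∀ x ∈ C, ∀ y ∈ C, x ≠ y → inner ℝ x y = -1 ∨ inner ℝ x y ^ 2 = 1 / 5)
include h1 hN hv

omit hN in
/-- The inner product of two points of `C` is `1`, `-1`, `a` or `-a` (`a = √5/5`). -/
theorem inner_cases {x y : EuclideanSpace ℝ (Fin 3)} (hx : x ∈ C) (hy : y ∈ C) :
    y = x ∨ y = -x ∨ inner ℝ x y = Real.sqrt 5 / 5 ∨ inner ℝ x y = -(Real.sqrt 5 / 5) := by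
  obtain ⟨h5, hlo, _⟩ := s5
  by_cases hxy : x = y
  · exact Or.inl hxy.symm
  rcases hv x hx y hy hxy with h | h
  · exact Or.inr (Or.inl (eq_neg_of_inner_eq_neg_one (h1 x hx) (h1 y hy) h))
  · have hsq : (inner ℝ x y) ^ 2 = (Real.sqrt 5 / 5) ^ 2 := by rw [h]; field_simp; linarith
    rcases sq_eq_sq_iff_eq_or_eq_neg.mp hsq with h' | h'
    · exact Or.inr (Or.inr (Or.inl h'))
    · exact Or.inr (Or.inr (Or.inr h'))

/-- Neighbours of `x`: the points of `C` at inner product `a = √5/5`. -/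
theorem card_nbr {x : EuclideanSpace ℝ (Fin 3)} (hx : x ∈ C) :
    (C.filter fun y => inner ℝ x y = Real.sqrt 5 / 5).card = 5 := by
  classical
  obtain ⟨h5, hlo, hhi⟩ := s5
  have ha0 : (0 : ℝ) < Real.sqrt 5 / 5 := by positivity
  have hnegC : ∀ y ∈ C, -y ∈ C := fun y hy => IcosahedronLines.neg_mem h1 hN hv hy
  set N := C.filter fun y => inner ℝ x y = Real.sqrt 5 / 5 with hNdef
  set M := C.filter fun y => inner ℝ x y = -(Real.sqrt 5 / 5) with hMdef
  -- `C = {x, -x} ∪ N ∪ M`, pairwise disjoint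
  have hx1 : inner ℝ x x = 1 := by rw [real_inner_self_eq_norm_sq, h1 x hx]; norm_num
  have hxm : inner ℝ x (-x) = -1 := by rw [inner_neg_right, hx1]
  have hdecomp : C = insert x (insert (-x) (N ∪ M)) := by
    ext y
    simp only [mem_insert, mem_union, hNdef, hMdef, mem_filter]
    constructor
    · intro hy
      rcases inner_cases h1 hv hx hy with h | h | h | h
      · exact Or.inl h
      · exact Or.inr (Or.inl h)
      · exact Or.inr (Or.inr (Or.inl ⟨hy, h⟩))
      · exact Or.inr (Or.inr (Or.inr ⟨hy, h⟩))
    · rintro (rfl | rfl | ⟨hy, _⟩ | ⟨hy, _⟩)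
      · exact hx
      · exact hnegC x hx
      · exact hy
      · exact hy
  have hxN : x ∉ N ∪ M := by
    simp only [mem_union, hNdef, hMdef, mem_filter, hx1, not_or, not_and]
    constructor <;> intro _ <;> linarith
  have hmxN : -x ∉ N ∪ M := by
    simp only [mem_union, hNdef, hMdef, mem_filter, hxm, not_or, not_and]
    constructor <;> intro _ <;> linarith
  have hxmx : x ≠ -x := by
    intro h
    have h2 : inner ℝ x (-x) = -1 := hxm
    rw [← h, hx1] at h2; linarith
  have hNM : Disjoint N M := by
    rw [Finset.disjoint_filter]; intro y _ h; rw [h]; linarith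
  -- negation is a bijection `N → M`
  have hcardNM : N.card = M.card := by
    refine Finset.card_bij (fun y _ => -y) (fun y hy => ?_) (fun y _ y' _ h => neg_inj.mp h) (fun z hz => ?_)
    · simp only [hNdef, hMdef, mem_filter] at hy ⊢
      exact ⟨hnegC y hy.1, by rw [inner_neg_right, hy.2]⟩
    · simp only [hNdef, hMdef, mem_filter] at hz ⊢
      exact ⟨-z, ⟨hnegC z hz.1, by rw [inner_neg_right, hz.2, neg_neg]⟩, neg_neg z⟩
  have hcount : C.card = 2 + N.card + M.card := by
    rw [hdecomp, card_insert_of_notMem, card_insert_of_notMem hmxN, card_union_of_disjoint hNM]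
    · ring
    · simp only [mem_insert, not_or]; exact ⟨hxmx, hxN⟩
  omega


/-! ### Neighbour sets and the two-plus-two split -/

omit hN hv in
/-- For `y₀` a neighbour of `x`, the other neighbours of `x` at inner product `q` from `y₀` are at most two
(mirror-or-equal lemma). -/
theorem card_filter_le_two {x y₀ : EuclideanSpace ℝ (Fin 3)} (hx : x ∈ C)
    (hy₀ : y₀ ∈ C) (hxy₀ : inner ℝ x y₀ = Real.sqrt 5 / 5) (q : ℝ) :
    ((C.filter fun y => inner ℝ x y = Real.sqrt 5 / 5).filter
      fun y => y ≠ y₀ ∧ inner ℝ y₀ y = q).card ≤ 2 := by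
  classical
  obtain ⟨h5, hlo, hhi⟩ := s5
  set S := (C.filter fun y => inner ℝ x y = Real.sqrt 5 / 5).filter fun y => y ≠ y₀ ∧ inner ℝ y₀ y = q
    with hSdef
  rcases S.eq_empty_or_nonempty with h | ⟨y, hy⟩
  · rw [h]; simp
  have ha1 : (Real.sqrt 5 / 5) ^ 2 ≠ 1 := by nlinarith
  have hyS := hy
  simp only [hSdef, mem_filter] at hyS
  have hsub : S ⊆ {y, (2 : ℝ) • (((Real.sqrt 5 / 5 - Real.sqrt 5 / 5 * q) / (1 - (Real.sqrt 5 / 5) ^ 2)) • x +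
      ((q - Real.sqrt 5 / 5 * (Real.sqrt 5 / 5)) / (1 - (Real.sqrt 5 / 5) ^ 2)) • y₀) - y} := by
    intro z hz
    simp only [hSdef, mem_filter] at hz
    rcases reflect_or_eq (h1 x hx) (h1 y₀ hy₀) (h1 y hyS.1.1) (h1 z hz.1.1) hxy₀ ha1 hyS.1.2 hz.1.2
      hyS.2.2 hz.2.2 with h | h
    · rw [h]; exact mem_insert_self _ _
    · rw [h]; exact mem_insert_of_mem (mem_singleton_self _)
  exact (card_le_card hsub).trans (Finset.card_le_two)

/-- For `y₀` a neighbour of `x`: exactly two other neighbours of `x` at `+a` from `y₀` and exactly two at `-a`. -/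
theorem card_filter_eq_two {x y₀ : EuclideanSpace ℝ (Fin 3)} (hx : x ∈ C)
    (hy₀ : y₀ ∈ C) (hxy₀ : inner ℝ x y₀ = Real.sqrt 5 / 5) :
    ((C.filter fun y => inner ℝ x y = Real.sqrt 5 / 5).filter
      fun y => y ≠ y₀ ∧ inner ℝ y₀ y = Real.sqrt 5 / 5).card = 2 := by
  classical
  obtain ⟨h5, hlo, hhi⟩ := s5
  set N := C.filter fun y => inner ℝ x y = Real.sqrt 5 / 5 with hNdef
  set Sp := N.filter fun y => y ≠ y₀ ∧ inner ℝ y₀ y = Real.sqrt 5 / 5 with hSp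
  set Sm := N.filter fun y => y ≠ y₀ ∧ inner ℝ y₀ y = -(Real.sqrt 5 / 5) with hSm
  have hp := card_filter_le_two h1 hx hy₀ hxy₀ (Real.sqrt 5 / 5)
  have hm := card_filter_le_two h1 hx hy₀ hxy₀ (-(Real.sqrt 5 / 5))
  rw [← hNdef] at hp hm
  rw [← hSp] at hp
  rw [← hSm] at hm
  have hy₀N : y₀ ∈ N := by rw [hNdef, mem_filter]; exact ⟨hy₀, hxy₀⟩
  have hN5 : N.card = 5 := card_nbr h1 hN hv hx
  -- `N.erase y₀ = Sp ∪ Sm`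
  have hunion : N.erase y₀ = Sp ∪ Sm := by
    ext y
    simp only [mem_erase, mem_union, hSp, hSm, mem_filter]
    constructor
    · rintro ⟨hne, hyN⟩
      have hyN' := hyN
      rw [hNdef, mem_filter] at hyN'
      have hyC : y ∈ C := hyN'.1
      have hxy : inner ℝ x y = Real.sqrt 5 / 5 := hyN'.2
      rcases inner_cases h1 hv hy₀ hyC with h | h | h | h
      · exact absurd h hne
      · exfalso
        rw [h, inner_neg_right, hxy₀] at hxy
        have : (0 : ℝ) < Real.sqrt 5 / 5 := by positivity
        linarith
      · exact Or.inl ⟨hyN, hne, h⟩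
      · exact Or.inr ⟨hyN, hne, h⟩
    · rintro (⟨hyN, hne, _⟩ | ⟨hyN, hne, _⟩) <;> exact ⟨hne, hyN⟩
  have hdisj : Disjoint Sp Sm := by
    rw [hSp, hSm, Finset.disjoint_filter]
    rintro y _ ⟨_, h⟩ ⟨_, h'⟩
    rw [h] at h'
    have : (0 : ℝ) < Real.sqrt 5 / 5 := by positivity
    linarith
  have hcard : Sp.card + Sm.card = 4 := by
    rw [← card_union_of_disjoint hdisj, ← hunion, card_erase_of_mem hy₀N, hN5]
  omega

omit h1 hN hv in
/-- The simplified mirror coefficient: `(a - a·a)/(1 - a²) = (√5 - 1)/4` for `a = √5/5`. -/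
private theorem coef_eq : (Real.sqrt 5 / 5 - Real.sqrt 5 / 5 * (Real.sqrt 5 / 5)) / (1 - (Real.sqrt 5 / 5) ^ 2) =
    (Real.sqrt 5 - 1) / 4 := by
  obtain ⟨h5, hlo, hhi⟩ := s5
  have hden : (1 : ℝ) - (Real.sqrt 5 / 5) ^ 2 = 4 / 5 := by nlinarith
  rw [hden, div_eq_iff (by norm_num)]
  nlinarith

/-- **The pentagon step.** For neighbours `y₀, y` of `x` at inner product `a` from each other, the mirror image
`R = ((√5-1)/2)(x + y₀) - y` is again a neighbour of `x`, distinct from `y` and `y₀`, at inner product `a` from `y₀`. -/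
theorem step {x y₀ y : EuclideanSpace ℝ (Fin 3)} (hx : x ∈ C) (hy₀ : y₀ ∈ C)
    (hxy₀ : inner ℝ x y₀ = Real.sqrt 5 / 5) (hy : y ∈ C) (hxy : inner ℝ x y = Real.sqrt 5 / 5)
    (hne : y ≠ y₀) (hq : inner ℝ y₀ y = Real.sqrt 5 / 5) :
    ((Real.sqrt 5 - 1) / 2) • (x + y₀) - y ∈ C ∧
      inner ℝ x (((Real.sqrt 5 - 1) / 2) • (x + y₀) - y) = Real.sqrt 5 / 5 ∧
      ((Real.sqrt 5 - 1) / 2) • (x + y₀) - y ≠ y ∧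
      inner ℝ y₀ (((Real.sqrt 5 - 1) / 2) • (x + y₀) - y) = Real.sqrt 5 / 5 := by
  classical
  obtain ⟨h5, hlo, hhi⟩ := s5
  set R := ((Real.sqrt 5 - 1) / 2) • (x + y₀) - y with hRdef
  set Sp := (C.filter fun y => inner ℝ x y = Real.sqrt 5 / 5).filter
    fun z => z ≠ y₀ ∧ inner ℝ y₀ z = Real.sqrt 5 / 5 with hSp
  have hcard := card_filter_eq_two h1 hN hv hx hy₀ hxy₀
  rw [← hSp] at hcard
  have hyS : y ∈ Sp := by simp only [hSp, mem_filter]; exact ⟨⟨hy, hxy⟩, hne, hq⟩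
  have ha1 : (Real.sqrt 5 / 5) ^ 2 ≠ 1 := by nlinarith
  -- every element of `Sp` is `y` or `R`
  have hform : (2 : ℝ) • (((Real.sqrt 5 / 5 - Real.sqrt 5 / 5 * (Real.sqrt 5 / 5)) /
      (1 - (Real.sqrt 5 / 5) ^ 2)) • x + ((Real.sqrt 5 / 5 - Real.sqrt 5 / 5 * (Real.sqrt 5 / 5)) /
      (1 - (Real.sqrt 5 / 5) ^ 2)) • y₀) - y = R := by
    rw [coef_eq, hRdef, ← smul_add, smul_smul]
    congr 1; congr 1; ring
  have hsub : Sp ⊆ {y, R} := by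
    intro z hz
    simp only [hSp, mem_filter] at hz
    rcases reflect_or_eq (h1 x hx) (h1 y₀ hy₀) (h1 y hy) (h1 z hz.1.1) hxy₀ ha1 hxy hz.1.2
      hq hz.2.2 with h | h
    · rw [h]; exact mem_insert_self _ _
    · rw [h, hform]; exact mem_insert_of_mem (mem_singleton_self _)
  have hRy : R ≠ y := by
    intro h
    have : Sp ⊆ {y} := by
      rw [h, Finset.insert_eq_of_mem (Finset.mem_singleton_self y)] at hsub; exact hsub
    have := card_le_card this
    rw [card_singleton] at this
    omega
  have heq : Sp = {y, R} := Finset.eq_of_subset_of_card_le hsub (by rw [card_pair hRy.symm, hcard])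
  have hRS : R ∈ Sp := by rw [heq]; exact mem_insert_of_mem (mem_singleton_self _)
  simp only [hSp, mem_filter] at hRS
  exact ⟨hRS.1.1, hRS.1.2, hRy, hRS.2.2⟩

end config

end Summit.Ventures.PackingBounds.Config.IcosahedronNbr

end
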